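import Mathlib.NumberTheory.Padics.Complex
import Mathlib.LinearAlgebra.Eigenspace.Charpoly
import Mathlib.RingTheory.Polynomial.Vieta
import Mathlib.RingTheory.Polynomial.Subring
import Mathlib.Analysis.Normed.Group.Bounded
import Mathlib.Algebra.Order.Archimedean.Basic
import Mathlib.Topology.Instances.Matrix
import Literature.NumberTheory.GaloisRepresentations.GaloisRep
import Literature.NumberTheory.GaloisRepresentations.AbsGaloisGroupCompact
import Literature.NumberTheory.GaloisRepresentations.IntegralGaloisActionProofs
import HarnessLib

/-!
# Characteristic polynomials of a compact-image `p`-adic representation are `p`-integral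

Topic `Literature/NumberTheory/GaloisRepresentations` (namespace
`Literature.NumberTheory.GaloisRepresentations`).  Everything here is PROVED (theorems only).
Written for the "wanted API" of definition item `defn-HasResidualPairVia` (route
`Langlands/PhantomRMYoshida`): "the automatic `p`-integrality of `charpoly ρ(Frob_v)` for compact
image (so the `∃ P` clause is about the factorisation only)" — the items of that route and of
`Langlands/PhantomRM` quantify `∃ P : Polynomial 𝒪[ℚ̄_p], ρ.HasFrobCharpolyAt v (P.map 𝒪.subtype) ∧ …`.

The argument (Serre, *Abelian ℓ-adic representations*, Ch. I §1.1–1.2 and §2.3: a continuous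
representation of a compact group stabilises a lattice, hence has integral characteristic
polynomials) is carried out WITHOUT lattices, which are not available over the non-discretely-valued
`ℚ̄_p = PadicAlgCl p`: 

* `norm_le_one_of_isRoot_charpoly_of_pow_bounded` — over any normed field, an eigenvalue `μ` of a
  matrix `N` whose powers `N^k` have uniformly bounded entries satisfies `‖μ‖ ≤ 1` (apply `N^k` to an
  eigenvector: `‖μ‖^k ‖v‖ ≤ card · C · ‖v‖` for all `k`);
* `FramedRep.exists_forall_norm_apply_le` — a continuous `ρ : G → GL_n(A)` on a compact group has
  uniformly bounded matrix entries; hence (`FramedRep.norm_le_one_of_isRoot_charpoly`) every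
  eigenvalue of every `ρ(g)` has norm `≤ 1`;
* `FramedRep.charpoly_coeff_mem_integer` — over `ℚ̄_p` (algebraically closed, valuation ring
  `𝒪 = {‖x‖ ≤ 1}` a subring), the coefficients of `charpoly ρ(g)` are, by Vieta
  (`Polynomial.coeff_eq_esymm_roots_of_splits`), signed elementary symmetric functions of the
  eigenvalues, hence lie in `𝒪[ℚ̄_p]`;
* `FramedRep.exists_charpoly_eq_map`, `FramedGaloisRep.exists_charpoly_eq_map` — **`charpoly ρ(g) =
  P.map 𝒪.subtype` for some `P ∈ 𝒪[ℚ̄_p][X]`**, for every `g` (compact `G`, resp. `Γ_K`, which is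
  compact: `absoluteGaloisGroup_compactSpace`);
* `FramedGaloisRep.HasFrobCharpolyAt.exists_eq_map` — consequently a Frobenius characteristic
  polynomial `Q` of `ρ : Γ_K → GL_n(ℚ̄_p)` at `v` (`ρ.HasFrobCharpolyAt v Q`, given that some
  arithmetic Frobenius at some `𝔓 ∣ v` exists) is of the form `P.map 𝒪.subtype`; for a NUMBER
  FIELD the existence is the tree's `exists_isArithFrobAt_of_mem_primesAbove_holds` with
  `primesAbove_nonempty`, giving the unconditional
  `FramedGaloisRep.HasFrobCharpolyAt.exists_eq_map_of_numberField`.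

## References
* J.-P. Serre, *Abelian ℓ-adic representations and elliptic curves* (1968), Ch. I §1.1 (Remark:
  compact image stabilises a lattice), §2.3. [SerreAbelianLadic1968]

## Mathlib / tree search
Mathlib: `Module.End.hasEigenvalue_iff_isRoot_charpoly`, `Matrix.charpoly_toLin'`,
`Polynomial.coeff_eq_esymm_roots_of_splits`, `IsAlgClosed.splits`, `Polynomial.toSubring`,
`Polynomial.map_toSubring`, `IsCompact.exists_bound_of_continuousOn`, `Continuous.matrix_elem`,
`pow_unbounded_of_one_lt`, `PadicAlgCl.valuation_def`; nothing on integrality of characteristic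
polynomials of compact subgroups (`lean search 'charpoly.*integer|integral.*charpoly'`: unrelated).
Tree: `FramedRep`, `FramedRep.charpoly`, `FramedGaloisRep.HasFrobCharpolyAt` (`GaloisRep`),
`absoluteGaloisGroup_compactSpace` (`AbsGaloisGroupCompact`),
`IsDedekindDomain.HeightOneSpectrum.primesAbove_nonempty` (`IntegralGaloisAction`),
`IsDedekindDomain.HeightOneSpectrum.exists_isArithFrobAt_of_mem_primesAbove_holds`
(`IntegralGaloisActionProofs`).
-/

noncomputable section

open Polynomial Field
open scoped Matrix

namespace Literature.NumberTheory.GaloisRepresentations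

/-! ### Eigenvalues of power-bounded matrices over a normed field -/

section PowerBounded

variable {A : Type*} [NormedField A] {m : Type*} [Fintype m] [DecidableEq m]

omit [DecidableEq m] in
/-- An entrywise bound `‖N i j‖ ≤ C` gives `‖N v‖_∞ ≤ card m · C · ‖v‖_∞`. [folklore] -/
theorem norm_mulVec_le_of_forall_norm_le {N : Matrix m m A} {C : ℝ} (hC : 0 ≤ C)
    (h : ∀ i j, ‖N i j‖ ≤ C) (w : m → A) :
    ‖N *ᵥ w‖ ≤ Fintype.card m * C * ‖w‖ := by
  refine (pi_norm_le_iff_of_nonneg (by positivity)).mpr fun i => ?_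
  calc ‖(N *ᵥ w) i‖ = ‖∑ j, N i j * w j‖ := rfl
    _ ≤ ∑ j, ‖N i j * w j‖ := norm_sum_le _ _
    _ ≤ ∑ _j : m, C * ‖w‖ := Finset.sum_le_sum fun j _ => by
        rw [norm_mul]
        exact mul_le_mul (h i j) (norm_le_pi_norm w j) (norm_nonneg _) hC
    _ = Fintype.card m * C * ‖w‖ := by
        rw [Finset.sum_const, Finset.card_univ, nsmul_eq_mul]
        ring

/-- Powers of a matrix act on an eigenvector by powers of the eigenvalue. [folklore] -/
theorem pow_mulVec_eq_pow_smul {N : Matrix m m A} {μ : A} {v : m → A} (hv : N *ᵥ v = μ • v)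
    (k : ℕ) : (N ^ k) *ᵥ v = μ ^ k • v := by
  induction k with
  | zero => simp
  | succ k ih =>
    rw [pow_succ, ← Matrix.mulVec_mulVec, hv, Matrix.mulVec_smul, ih, smul_smul, ← pow_succ']

/-- **Eigenvalues of a power-bounded matrix have norm at most `1`**: if the entries of all powers
`N^k` are bounded by `C`, every root `μ` of `charpoly N` satisfies `‖μ‖ ≤ 1` (apply `N^k` to an
eigenvector `v ≠ 0`: `‖μ‖^k ‖v‖ = ‖N^k v‖ ≤ card · C · ‖v‖`, and `‖μ‖^k` would be unbounded if
`‖μ‖ > 1`). [folklore] -/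
theorem norm_le_one_of_isRoot_charpoly_of_pow_bounded {N : Matrix m m A} {C : ℝ}
    (hC : ∀ k : ℕ, ∀ i j, ‖(N ^ k) i j‖ ≤ C) {μ : A} (hμ : N.charpoly.IsRoot μ) : ‖μ‖ ≤ 1 := by
  have hev : Module.End.HasEigenvalue (Matrix.toLin' N) μ := by
    rw [Module.End.hasEigenvalue_iff_isRoot_charpoly, Matrix.charpoly_toLin']
    exact hμ
  obtain ⟨v, hv⟩ := hev.exists_hasEigenvector
  have hv0 : v ≠ 0 := hv.2
  have hNv : N *ᵥ v = μ • v := by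
    have h := hv.apply_eq_smul
    rwa [Matrix.toLin'_apply] at h
  have hvpos : 0 < ‖v‖ := norm_pos_iff.mpr hv0
  have hm : Nonempty m := by
    by_contra h
    rw [not_nonempty_iff] at h
    exact hv0 (Subsingleton.elim _ _)
  obtain ⟨i₀⟩ := hm
  have hC0 : 0 ≤ C := (norm_nonneg _).trans (hC 0 i₀ i₀)
  have hbound : ∀ k : ℕ, ‖μ‖ ^ k ≤ Fintype.card m * C := by
    intro k
    have h1 : ‖(N ^ k) *ᵥ v‖ ≤ Fintype.card m * C * ‖v‖ :=
      norm_mulVec_le_of_forall_norm_le hC0 (hC k) v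
    rw [pow_mulVec_eq_pow_smul hNv, norm_smul, norm_pow] at h1
    exact le_of_mul_le_mul_right h1 hvpos
  by_contra hlt
  rw [not_le] at hlt
  obtain ⟨k, hk⟩ := pow_unbounded_of_one_lt (Fintype.card m * C) hlt
  exact absurd (hbound k) (not_le.mpr hk)

end PowerBounded

/-! ### Compact image: bounded entries, eigenvalues of norm `≤ 1` -/

section CompactImage

variable {G : Type*} [Group G] [TopologicalSpace G] [CompactSpace G]
variable {A : Type*} [NormedField A] {n : ℕ}

/-- The matrix entries of a continuous representation `ρ : G → GL_n(A)` of a COMPACT group are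
uniformly bounded. [folklore] -/
theorem FramedRep.exists_forall_norm_apply_le (ρ : FramedRep G A n) :
    ∃ C : ℝ, ∀ (g : G) (i j : Fin n), ‖((ρ g : GL (Fin n) A) : Matrix (Fin n) (Fin n) A) i j‖ ≤ C := by
  set f : G → (Fin n → Fin n → A) :=
    fun g i j => ((ρ g : GL (Fin n) A) : Matrix (Fin n) (Fin n) A) i j with hf_def
  have hf : Continuous f := by
    refine continuous_pi fun i => continuous_pi fun j => ?_
    exact (Units.continuous_val.comp (map_continuous ρ)).matrix_elem i j
  obtain ⟨C, hC⟩ := isCompact_univ.exists_bound_of_continuousOn hf.continuousOn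
  refine ⟨C, fun g i j => ?_⟩
  exact ((norm_le_pi_norm (f g i) j).trans (norm_le_pi_norm (f g) i)).trans (hC g (Set.mem_univ g))

/-- **Every eigenvalue of `ρ(g)` has norm `≤ 1`** for a continuous representation of a compact
group over a normed field (the powers `ρ(g)^k = ρ(g^k)` stay in the bounded image).
Ref: Serre 1968, Ch. I §1.1. [folklore] -/
theorem FramedRep.norm_le_one_of_isRoot_charpoly (ρ : FramedRep G A n) (g : G) {μ : A}
    (hμ : (FramedRep.charpoly ρ g).IsRoot μ) : ‖μ‖ ≤ 1 := by
  obtain ⟨C, hC⟩ := FramedRep.exists_forall_norm_apply_le ρ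
  refine norm_le_one_of_isRoot_charpoly_of_pow_bounded
    (N := ((ρ g : GL (Fin n) A) : Matrix (Fin n) (Fin n) A)) (C := C) (fun k i j => ?_) hμ
  have h : ((ρ g : GL (Fin n) A) : Matrix (Fin n) (Fin n) A) ^ k =
      ((ρ (g ^ k) : GL (Fin n) A) : Matrix (Fin n) (Fin n) A) := by
    rw [map_pow, Units.val_pow_eq_pow_val]
  rw [h]
  exact hC (g ^ k) i j

end CompactImage

/-! ### Over `ℚ̄_p`: integral characteristic polynomials -/

section Padic

variable {p : ℕ} [Fact p.Prime]
variable {G : Type*} [Group G] [TopologicalSpace G] [CompactSpace G] {n : ℕ}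

/-- `‖x‖ ≤ 1` means `x ∈ 𝒪[ℚ̄_p]` (`Valued.v x = ‖x‖₊`, Mathlib `PadicAlgCl.valuation_def`).
[folklore] -/
theorem PadicAlgCl.mem_integer_of_norm_le_one {x : PadicAlgCl p} (h : ‖x‖ ≤ 1) :
    x ∈ Valued.integer (PadicAlgCl p) := by
  change Valued.v x ≤ 1
  rw [PadicAlgCl.valuation_def]
  exact_mod_cast h

/-- **The coefficients of `charpoly ρ(g)` lie in `𝒪[ℚ̄_p]`** for a continuous representation
`ρ : G → GL_n(ℚ̄_p)` of a compact group: `charpoly` is monic and splits over the algebraically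
closed `ℚ̄_p`, its coefficients are `±` elementary symmetric functions of the eigenvalues (Vieta),
and these have norm `≤ 1`, i.e. lie in the valuation RING `𝒪`.
Ref: Serre 1968, Ch. I §1.1, §2.3. [cite: SerreAbelianLadic1968, Ch. I §2.3] -/
theorem FramedRep.charpoly_coeff_mem_integer (ρ : FramedRep G (PadicAlgCl p) n) (g : G) (k : ℕ) :
    (FramedRep.charpoly ρ g).coeff k ∈ Valued.integer (PadicAlgCl p) := by
  set P := FramedRep.charpoly ρ g with hP
  have hmonic : P.Monic := Matrix.charpoly_monic _
  by_cases hk : k ≤ P.natDegree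
  · rw [Polynomial.coeff_eq_esymm_roots_of_splits (IsAlgClosed.splits P) hk, hmonic.leadingCoeff,
      one_mul]
    refine Subring.mul_mem _ (Subring.pow_mem _ (Subring.neg_mem _ (Subring.one_mem _)) _) ?_
    rw [Multiset.esymm]
    refine Subring.multiset_sum_mem _ _ fun x hx => ?_
    obtain ⟨t, ht, rfl⟩ := Multiset.mem_map.mp hx
    refine Subring.multiset_prod_mem _ _ fun y hy => ?_
    have hyt : y ∈ P.roots := Multiset.mem_of_le (Multiset.mem_powersetCard.mp ht).1 hy
    have hroot : P.IsRoot y := (Polynomial.mem_roots hmonic.ne_zero).mp hyt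
    exact PadicAlgCl.mem_integer_of_norm_le_one (FramedRep.norm_le_one_of_isRoot_charpoly ρ g hroot)
  · rw [Polynomial.coeff_eq_zero_of_natDegree_lt (not_le.mp hk)]
    exact Subring.zero_mem _

/-- **`charpoly ρ(g) = P.map 𝒪.subtype` for some `P ∈ 𝒪[ℚ̄_p][X]`** (compact `G`): the integral
model of the characteristic polynomial (`Polynomial.toSubring`).
[cite: SerreAbelianLadic1968, Ch. I §2.3] -/
theorem FramedRep.exists_charpoly_eq_map (ρ : FramedRep G (PadicAlgCl p) n) (g : G) :
    ∃ P : Polynomial (Valued.integer (PadicAlgCl p)),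
      P.map (Valued.integer (PadicAlgCl p)).subtype = FramedRep.charpoly ρ g := by
  refine ⟨(FramedRep.charpoly ρ g).toSubring (Valued.integer (PadicAlgCl p)) ?_,
    Polynomial.map_toSubring _ _ _⟩
  intro c hc
  obtain ⟨k, -, rfl⟩ := Polynomial.mem_coeffs_iff.mp (Finset.mem_coe.mp hc)
  exact FramedRep.charpoly_coeff_mem_integer ρ g k

/-- **Galois case**: for `ρ : Γ_K → GL_n(ℚ̄_p)` continuous (`Γ_K` is compact,
`absoluteGaloisGroup_compactSpace`), every `charpoly ρ(g)` is `P.map 𝒪.subtype` for some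
`P ∈ 𝒪[ℚ̄_p][X]`. [cite: SerreAbelianLadic1968, Ch. I §2.3] -/
theorem FramedGaloisRep.exists_charpoly_eq_map {K : Type*} [Field K]
    (ρ : FramedGaloisRep K (PadicAlgCl p) n) (g : absoluteGaloisGroup K) :
    ∃ P : Polynomial (Valued.integer (PadicAlgCl p)),
      P.map (Valued.integer (PadicAlgCl p)).subtype = FramedRep.charpoly ρ g := by
  haveI : CompactSpace (absoluteGaloisGroup K) := absoluteGaloisGroup_compactSpace K
  exact FramedRep.exists_charpoly_eq_map ρ g

/-- **Frobenius characteristic polynomials are `p`-integral**: if `Q` is the characteristic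
polynomial of the arithmetic Frobenii of `ρ : Γ_K → GL_n(ℚ̄_p)` at `v` (`ρ.HasFrobCharpolyAt v Q`)
and some arithmetic Frobenius at some `𝔓 ∣ v` exists (always, for a number field), then
`Q = P.map 𝒪.subtype` for some `P ∈ 𝒪[ℚ̄_p][X]` — so in `∃ P, ρ.HasFrobCharpolyAt v (P.map 𝒪.subtype)`
the integrality is automatic. [cite: SerreAbelianLadic1968, Ch. I §2.3] -/
theorem FramedGaloisRep.HasFrobCharpolyAt.exists_eq_map {K : Type*} [Field K]
    {v : IsDedekindDomain.HeightOneSpectrum (NumberField.RingOfIntegers K)}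
    {Q : Polynomial (PadicAlgCl p)} {ρ : FramedGaloisRep K (PadicAlgCl p) n}
    (h : ρ.HasFrobCharpolyAt v Q)
    (hex : ∃ 𝔓 ∈ v.primesAbove, ∃ σ : absoluteGaloisGroup K,
      IsArithFrobAt (NumberField.RingOfIntegers K) σ 𝔓) :
    ∃ P : Polynomial (Valued.integer (PadicAlgCl p)),
      P.map (Valued.integer (PadicAlgCl p)).subtype = Q := by
  obtain ⟨𝔓, h𝔓, σ, hσ⟩ := hex
  rw [← h 𝔓 h𝔓 σ hσ]
  exact FramedGaloisRep.exists_charpoly_eq_map ρ σ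

/-- **Frobenius characteristic polynomials over a number field are `p`-integral**, unconditionally:
`ρ.HasFrobCharpolyAt v Q → ∃ P ∈ 𝒪[ℚ̄_p][X], P.map 𝒪.subtype = Q` (a prime `𝔓 ∣ v` of `ℤ̄_K` and an
arithmetic Frobenius at it exist: `primesAbove_nonempty`,
`exists_isArithFrobAt_of_mem_primesAbove_holds`). [cite: SerreAbelianLadic1968, Ch. I §2.3] -/
theorem FramedGaloisRep.HasFrobCharpolyAt.exists_eq_map_of_numberField {K : Type*} [Field K]
    [NumberField K] {v : IsDedekindDomain.HeightOneSpectrum (NumberField.RingOfIntegers K)}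
    {Q : Polynomial (PadicAlgCl p)} {ρ : FramedGaloisRep K (PadicAlgCl p) n}
    (h : ρ.HasFrobCharpolyAt v Q) :
    ∃ P : Polynomial (Valued.integer (PadicAlgCl p)),
      P.map (Valued.integer (PadicAlgCl p)).subtype = Q := by
  obtain ⟨𝔓, h𝔓⟩ := IsDedekindDomain.HeightOneSpectrum.primesAbove_nonempty v
  exact h.exists_eq_map
    ⟨𝔓, h𝔓, IsDedekindDomain.HeightOneSpectrum.exists_isArithFrobAt_of_mem_primesAbove_holds h𝔓⟩

end Padic

end Literature.NumberTheory.GaloisRepresentations
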